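import Mathlib
import Literature.Geometry.Riemannian.SphericalCylinderEntropy
import Literature.Geometry.Riemannian.SphericalZonalSixPositivity
import Literature.Geometry.Manifold.CylinderSlice
import HarnessLib

/-!
# Stub `stub_zonalMonotone`: the typed zonal heat kernel of `S⁴` is monotone in `s = cos(dist)`

Stub `stub_zonalMonotone` of line `ball-mass-slack` of the crux `CylinderEntropy.ThinCrossSectionExists`
(`stmt-SmoothPoincare4-7633`), proved with its registered statement verbatim: for every `τ > 0`,
`s ↦ zonal τ s = ∑_k e^{-k(k+3)τ} (2k+3)/3 · C_k^{(3/2)}(s)` is monotone on `[-1, 1]` (the heat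
kernel of the round `S⁴` is a non-increasing function of the geodesic distance; Cheeger–Yau 1981).

The proof is the Literature chain `SphericalZonalKernelSeries` (summability for all `τ > 0`) →
`SphericalZonalKernelSeriesDeriv` (`∂_s zonal = 5 e^{-4τ} zonalSix`, reduction to `zonalSix ≥ 0`) →
`GegenbauerExplicitODE` / `GegenbauerHeatPositivity` / `GegenbauerOrthogonality` (ultraspherical
equation, positivity preservation of the polynomial heat flow by the energy method, orthogonality and
norms of the `C_j^{(5/2)}`) → `SphericalZonalSixDuality` (`∫ (1-s²)² zonalSix p = h₀ (P_τ p)(1) ≥ 0`)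
→ `SphericalZonalSixPositivity` (`zonalSix ≥ 0` by polynomial approximation; `monotoneOn_zonal`).

Everything here is proved; no facts and no `Prop`-valued definitions are introduced.
-/

noncomputable section

open scoped BigOperators Topology MeasureTheory ENNReal NNReal
open Set Function MeasureTheory
open Literature.Geometry.Riemannian.SphericalCylinderEntropy (cylEntropy cylDensity cylKernel zonal wt gegen
  cylKernel_eq abs_sum_mul_le_one hausdorffMeasure_sphere_four_pos hausdorffMeasure_sphere_four_lt_top)
open Literature.Geometry.Manifold.CylinderSlice (sliceMap range_sliceMap)

set_option linter.dupNamespace false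

namespace Summit.SmoothPoincare4.SmoothPoincare4.Theorems.ThinCrossSectionExists.BallMassSlack

/-- **Stub B** (`stub_zonalMonotone`): for every `τ > 0` the typed zonal kernel `s ↦ zonal τ s` of
`S⁴` is monotone on `[-1, 1]` — the heat kernel of the round `S⁴` is radially non-increasing
(Cheeger–Yau 1981), here from `∂_s zonal = 5e^{-4τ} zonalSix ≥ 0` (positivity of the `S⁶` heat
series, `Literature.Geometry.Riemannian.SphericalZonalKernelSeries.monotoneOn_zonal`). [folklore] -/
theorem stub_zonalMonotone :
    ∀ τ : ℝ, 0 < τ → MonotoneOn (zonal τ) (Set.Icc (-1) 1) :=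
  fun _ hτ => Literature.Geometry.Riemannian.SphericalZonalKernelSeries.monotoneOn_zonal hτ

end Summit.SmoothPoincare4.SmoothPoincare4.Theorems.ThinCrossSectionExists.BallMassSlack
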